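import Summits.AnomalousDissipation.AnomalousDissipation.Theorems.SawtoothPulseCascadeK1LocalisedCascadeViscousCoupling
import Summits.AnomalousDissipation.AnomalousDissipation.Theorems.SawtoothPulseCascadeK1LocalisedCascadeSlotRestart

/-!
# K1loc, line `Spectral` — S-D (first good piece): THE `κ → 0` START TRANSFER TO THE INVISCID ITERATE

Helper file of the prover lane on the crux `K1LocalisedCascade` (stmt-AnomalousDissipation-19491), route
`SawtoothPulseCascade`, registered line `Cruxes.K1LocalisedCascade.Spectral` (one open stub `stub_highModeConcentration`).
Companion of `…ViscousCoupling`.  The INVISCID ITERATE of a datum `a 0` through the cascade is the explicit sequence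
`b j = a j ∘ Φ_{H,j}⁻¹`, `a (j+1) = b j ∘ Φ_{V,j}⁻¹` (`Φ_{H,j}⁻¹ = shearMap 0 1 (γ•U_j)`, `Φ_{V,j}⁻¹ = shearMap 1 0 (γ•U_j)`:
composition with the inverse pulse maps — no PDE is solved).  For every classical cascade scalar `w` on `[0,1)`
(`Torus.IsClassicalScalarTransportOn (Ico 0 1) κ P.field w`, `κ ≥ 0`) this file proves, with `A` a bound for the
transported enstrophies of the iterates on the first `n` phases (hypotheses `hAH`, `hAV`, the shape consumed by
`…K1Start.integral_comp_shearH/V_mul_ge_of_Ico`):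

* `integral_mul_ge_chain` — `∫ aₙ · w(tStart n) ≥ ∫ a₀ · w(0) − A √κ Σ_{j<n} √(tHalf j)(√D_{H,j} + √D_{V,j})`
  (`D` = the scalar dissipation on the half-slots; induction over the phases);
* `sum_sqrt_dissipation_le` — `Σ_{j<n} √(tHalf j)(√D_{H,j} + √D_{V,j}) ≤ √(tStart n · ‖w(0)‖²/2)` (Cauchy–Schwarz over the
  `2n` half-slots, `Σ 2 tHalf j = tStart n`, and the telescoped energy identity `Σ (D_H + D_V) = (‖w(0)‖² − ‖w(tStart n)‖²)/2`);
* `integral_sub_sq_le` — for `a 0 = w 0`: **`∫ (w(tStart n) − aₙ)² ≤ A √(2 κ · tStart n · ‖w(0)‖²)`** (the iterates are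
  measure-preserving rearrangements of the datum, `‖aₙ‖ = ‖w(0)‖`, and `‖w(tStart n)‖ ≤ ‖w(0)‖`);
* `sqrt_tsum_symbol_sq_le_inviscid_add` — the START SOCKET of the energy ledger
  (`…K1Ledger.highModeConcentration_of_ledger_threshold`, hypothesis `hstart`) transferred to the inviscid iterate: for any
  symbol `|μ| ≤ 1`, `√(Σ μ²|𝓕(w(tStart n))|²) ≤ √(Σ μ²|𝓕aₙ|²) + (A √(2κ · tStart n · ‖w(0)‖²))^{1/2}`
  (`…K1Slot.sqrt_tsum_symbol_sq_add_le`), and `sqrt_tsum_symbol_sq_le_of_inviscid` — the `hstart`-shaped corollary,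
  uniform in `0 < κ ≤ κ₁`.

So the first good piece `q₀` of the stub is `q₀ = q⁰(a_{i₀}) + (A √(2κ₁ · tStart i₀ · ‖θ₀‖²))^{1/2}` where `q⁰` bounds the
tracked energy of ONE explicit function; `κ₁` can then be taken as small as the ledger likes (only `∃ κ₀ > 0` is asked).
WHAT THIS IS NOT: no bound on `q⁰` (the window/zone analysis of the inviscid iterate, memo v8) and no value of `A`
(`≈ 2π(1+γ)^{2 i₀}` for the datum `sin 2πx₁`, to be discharged with the iterate); valid for every `CascadeParams` with
`γ ≥ 0`, `δ₀ > 0`, `d > 0`. [cite: DEIJ2022, (1.2)–(1.3) (energy identity)] [cite: BedrossianCotiZelati2017, §2]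
[cite: Grafakos2014, Prop. 3.2.7 (3) (Parseval)] [problem: turb]
-/

-- `Summit.<Summit>.<Problem>`: single-conjunct summit, the duplicate namespace segment is deliberate.
set_option linter.dupNamespace false

noncomputable section

namespace Summit.AnomalousDissipation.AnomalousDissipation.Theorems.SawtoothPulseCascade.K1Start

open MeasureTheory Set Filter Topology UnitAddTorus Function
open scoped ContDiff InnerProductSpace
open Literature.Analysis Literature.Analysis.FunctionSpaces Literature.Analysis.FunctionSpaces.Torus
open Literature.Analysis.FluidPDE.ShearStage
open Summit.AnomalousDissipation.AnomalousDissipation.Theorems.SawtoothPulseCascade.K1Slot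
open Literature.Analysis.FluidPDE.SawtoothCascade Literature.Analysis.FluidPDE.SawtoothCascade.CascadeParams

variable (P : CascadeParams)

/-! ## §1 The pairing with the inviscid iterate along the phases -/

/-- **The viscous solution stays paired with the inviscid iterate.**  For a classical cascade scalar `w` on `[0,1)`
(`κ ≥ 0`, `γ ≥ 0`, `δ₀ > 0`, `d > 0`), the inviscid iterate `(a j, b j)` of a smooth `a 0` (`b j = a j ∘ shearMap 0 1 (γ•U_j)`,
`a (j+1) = b j ∘ shearMap 1 0 (γ•U_j)`) with transported enstrophies `≤ A²` on the first `n` phases (`Q j = U_j'`):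
`∫ aₙ · w(tStart n) ≥ ∫ a₀ · w(0) − A √κ · Σ_{j<n} √(tHalf j) (√D_{H,j} + √D_{V,j})`, `D_{H,j}`, `D_{V,j}` the scalar
dissipation of `w` on the two half-slots of phase `j`. [cite: BedrossianCotiZelati2017, §2] [cite: DEIJ2022, (1.2)–(1.3)] -/
theorem integral_mul_ge_chain (hγ : 0 ≤ P.γ) (hδ₀ : 0 < P.δ₀) (hd : 0 < P.d) (Q : ℕ → ShearProfile)
    (hQ : ∀ j y, Q j y = deriv (P.U j) y) {κ A : ℝ} (hκ : 0 ≤ κ) (hA : 0 ≤ A)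
    {w : ℝ → UnitAddTorus (Fin 2) → ℝ} (hw : FluidPDE.Torus.IsClassicalScalarTransportOn (Ico 0 1) κ P.field w)
    (a b : ℕ → UnitAddTorus (Fin 2) → ℝ) (has : ∀ j, IsSmooth (a j))
    (hb : ∀ j, b j = a j ∘ shearMap 0 1 (amp ⟨P.U j, P.U_periodic j, P.contDiff_U (P.δ_pos hδ₀ hd j)⟩ P.γ))
    (hab : ∀ j, a (j + 1) = b j ∘ shearMap 1 0 (amp ⟨P.U j, P.U_periodic j, P.contDiff_U (P.δ_pos hδ₀ hd j)⟩ P.γ))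
    (n : ℕ)
    (hAH : ∀ j < n, ∀ c ∈ Icc 0 P.γ, (∫ x, partialDeriv (0 : Fin 2) (a j) x ^ 2) +
        ∫ x, (partialDeriv (1 : Fin 2) (a j) x - c * (Q j).onCircle (x 1) * partialDeriv (0 : Fin 2) (a j) x) ^ 2 ≤
          A ^ 2)
    (hAV : ∀ j < n, ∀ c ∈ Icc 0 P.γ, (∫ x, partialDeriv (1 : Fin 2) (b j) x ^ 2) +
        ∫ x, (partialDeriv (0 : Fin 2) (b j) x - c * (Q j).onCircle (x 0) * partialDeriv (1 : Fin 2) (b j) x) ^ 2 ≤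
          A ^ 2) :
    (∫ x, a 0 x * w 0 x) - A * Real.sqrt κ * ∑ j ∈ Finset.range n, Real.sqrt (tHalf j) *
        (Real.sqrt (FluidPDE.Torus.scalarDissipation κ w (tStart j) (tStart j + tHalf j)) +
          Real.sqrt (FluidPDE.Torus.scalarDissipation κ w (tStart j + tHalf j) (tStart (j + 1)))) ≤
      ∫ x, a n x * w (tStart n) x := by
  induction n with
  | zero => simp [tStart]
  | succ n ih =>
    have ih' := ih (fun j hj => hAH j (hj.trans n.lt_succ_self)) (fun j hj => hAV j (hj.trans n.lt_succ_self))
    have hbn : IsSmooth (b n) := by rw [hb n]; exact (has n).comp_shearMap 0 1 _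
    have hH := integral_comp_shearH_mul_ge_of_Ico P hγ hδ₀ hd n (Q n) (hQ n) hκ hA hw (has n)
      (hAH n n.lt_succ_self)
    have hV := integral_comp_shearV_mul_ge_of_Ico P hγ hδ₀ hd n (Q n) (hQ n) hκ hA hw hbn (hAV n n.lt_succ_self)
    have eH : (fun x => a n (shearMap 0 1 (amp ⟨P.U n, P.U_periodic n, P.contDiff_U (P.δ_pos hδ₀ hd n)⟩ P.γ) x) *
        w (tStart n + tHalf n) x) = fun x => b n x * w (tStart n + tHalf n) x := by
      funext x; rw [hb n]; rfl
    have eV : (fun x => b n (shearMap 1 0 (amp ⟨P.U n, P.U_periodic n, P.contDiff_U (P.δ_pos hδ₀ hd n)⟩ P.γ) x) *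
        w (tStart (n + 1)) x) = fun x => a (n + 1) x * w (tStart (n + 1)) x := by
      funext x; rw [hab n]; rfl
    rw [eH] at hH
    rw [eV] at hV
    rw [Finset.sum_range_succ, Real.sqrt_mul hκ] at *
    have h0 : 0 ≤ A * Real.sqrt κ := mul_nonneg hA (Real.sqrt_nonneg κ)
    set SH := Real.sqrt (FluidPDE.Torus.scalarDissipation κ w (tStart n) (tStart n + tHalf n))
    set SV := Real.sqrt (FluidPDE.Torus.scalarDissipation κ w (tStart n + tHalf n) (tStart (n + 1)))
    set τ := Real.sqrt (tHalf n)
    have e1 : A * (Real.sqrt κ * τ) * SH = A * Real.sqrt κ * (τ * SH) := by ring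
    have e2 : A * (Real.sqrt κ * τ) * SV = A * Real.sqrt κ * (τ * SV) := by ring
    rw [e1] at hH
    rw [e2] at hV
    nlinarith [hH, hV, ih', h0]

/-! ## §2 Cauchy–Schwarz over the half-slots and the telescoped energy identity -/

/-- **The telescoped energy identity**: `Σ_{j<n} (D_{H,j} + D_{V,j}) = (‖w(0)‖² − ‖w(tStart n)‖²)/2` for a classical cascade
scalar on `[0,1)`. [cite: DEIJ2022, (1.2)–(1.3)] -/
theorem sum_dissipation_eq {κ : ℝ} {w : ℝ → UnitAddTorus (Fin 2) → ℝ}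
    (hw : FluidPDE.Torus.IsClassicalScalarTransportOn (Ico 0 1) κ P.field w) (n : ℕ) :
    ∑ j ∈ Finset.range n, (FluidPDE.Torus.scalarDissipation κ w (tStart j) (tStart j + tHalf j) +
        FluidPDE.Torus.scalarDissipation κ w (tStart j + tHalf j) (tStart (j + 1))) =
      (FluidPDE.Torus.scalarL2Sq (w 0) - FluidPDE.Torus.scalarL2Sq (w (tStart n))) / 2 := by
  induction n with
  | zero => simp [tStart]
  | succ n ih =>
    have h1 := FluidPDE.Torus.IsClassicalScalarTransportOn.scalarL2Sq_add_scalarDissipation_holds hw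
      (show tStart n ≤ tStart n + tHalf n by linarith [tHalf_pos n]) (CascadeParams.Icc_H_subset_Ico n)
    have h2 := FluidPDE.Torus.IsClassicalScalarTransportOn.scalarL2Sq_add_scalarDissipation_holds hw
      (show tStart n + tHalf n ≤ tStart (n + 1) by rw [tStart_succ]; linarith [tHalf_pos n])
      (CascadeParams.Icc_V_subset_Ico n)
    rw [Finset.sum_range_succ, ih]
    linarith

/-- **Cauchy–Schwarz over the `2n` half-slots**: `Σ_{j<n} √(tHalf j)(√D_{H,j} + √D_{V,j}) ≤ √(tStart n · ‖w(0)‖²/2)`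
(`Σ_{j<n} 2 tHalf j = tStart n`, `sum_dissipation_eq`, `κ ≥ 0`). [cite: DEIJ2022, (1.2)–(1.3)] -/
theorem sum_sqrt_dissipation_le {κ : ℝ} (hκ : 0 ≤ κ) {w : ℝ → UnitAddTorus (Fin 2) → ℝ}
    (hw : FluidPDE.Torus.IsClassicalScalarTransportOn (Ico 0 1) κ P.field w) (n : ℕ) :
    ∑ j ∈ Finset.range n, Real.sqrt (tHalf j) *
        (Real.sqrt (FluidPDE.Torus.scalarDissipation κ w (tStart j) (tStart j + tHalf j)) +
          Real.sqrt (FluidPDE.Torus.scalarDissipation κ w (tStart j + tHalf j) (tStart (j + 1)))) ≤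
      Real.sqrt (tStart n * (FluidPDE.Torus.scalarL2Sq (w 0) / 2)) := by
  set DH : ℕ → ℝ := fun j => FluidPDE.Torus.scalarDissipation κ w (tStart j) (tStart j + tHalf j) with hDH
  set DV : ℕ → ℝ := fun j => FluidPDE.Torus.scalarDissipation κ w (tStart j + tHalf j) (tStart (j + 1)) with hDV
  have hDH0 : ∀ j, 0 ≤ DH j := fun j =>
    FluidPDE.Torus.scalarDissipation_nonneg hκ w (by linarith [tHalf_pos j])
  have hDV0 : ∀ j, 0 ≤ DV j := fun j =>
    FluidPDE.Torus.scalarDissipation_nonneg hκ w (by rw [tStart_succ]; linarith [tHalf_pos j])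
  have hτ0 : ∀ j, 0 ≤ tHalf j := fun j => (tHalf_pos j).le
  -- the two Cauchy–Schwarz sums
  have hCSH := Real.sum_sqrt_mul_sqrt_le (Finset.range n) hτ0 hDH0
  have hCSV := Real.sum_sqrt_mul_sqrt_le (Finset.range n) hτ0 hDV0
  have hsum : ∑ j ∈ Finset.range n, Real.sqrt (tHalf j) * (Real.sqrt (DH j) + Real.sqrt (DV j)) =
      (∑ j ∈ Finset.range n, Real.sqrt (tHalf j) * Real.sqrt (DH j)) +
        ∑ j ∈ Finset.range n, Real.sqrt (tHalf j) * Real.sqrt (DV j) := by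
    rw [← Finset.sum_add_distrib]; exact Finset.sum_congr rfl fun j _ => by ring
  -- `Σ tHalf = tStart n / 2`, `Σ (DH + DV) = (L₀ - L_n)/2 ≤ L₀/2`
  have hT : ∑ j ∈ Finset.range n, tHalf j = tStart n / 2 := by
    rw [tStart_eq_sum, ← Finset.mul_sum]
    ring
  have hD : (∑ j ∈ Finset.range n, DH j) + ∑ j ∈ Finset.range n, DV j ≤ FluidPDE.Torus.scalarL2Sq (w 0) / 2 := by
    rw [← Finset.sum_add_distrib]
    have h := sum_dissipation_eq P hw n
    simp only [hDH, hDV] at h ⊢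
    rw [h]
    linarith [FluidPDE.Torus.scalarL2Sq_nonneg (w (tStart n))]
  set T := ∑ j ∈ Finset.range n, tHalf j with hTdef
  set X := ∑ j ∈ Finset.range n, DH j with hXdef
  set Y := ∑ j ∈ Finset.range n, DV j with hYdef
  have hX0 : 0 ≤ X := Finset.sum_nonneg fun j _ => hDH0 j
  have hY0 : 0 ≤ Y := Finset.sum_nonneg fun j _ => hDV0 j
  have hT0 : 0 ≤ T := Finset.sum_nonneg fun j _ => hτ0 j
  -- `√T √X + √T √Y ≤ √(2T (X+Y))`
  have hkey : Real.sqrt T * Real.sqrt X + Real.sqrt T * Real.sqrt Y ≤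
      Real.sqrt (tStart n * (FluidPDE.Torus.scalarL2Sq (w 0) / 2)) := by
    have hXY : Real.sqrt X + Real.sqrt Y ≤ Real.sqrt (2 * (X + Y)) := by
      rw [show (2 : ℝ) * (X + Y) = X + Y + 2 * (Real.sqrt X * Real.sqrt Y) + (Real.sqrt X - Real.sqrt Y) ^ 2 by
        nlinarith [Real.sq_sqrt hX0, Real.sq_sqrt hY0]]
      refine (le_abs_self _).trans (Real.abs_le_sqrt ?_)
      nlinarith [Real.sq_sqrt hX0, Real.sq_sqrt hY0, sq_nonneg (Real.sqrt X - Real.sqrt Y)]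
    calc Real.sqrt T * Real.sqrt X + Real.sqrt T * Real.sqrt Y = Real.sqrt T * (Real.sqrt X + Real.sqrt Y) := by ring
      _ ≤ Real.sqrt T * Real.sqrt (2 * (X + Y)) := mul_le_mul_of_nonneg_left hXY (Real.sqrt_nonneg _)
      _ = Real.sqrt (T * (2 * (X + Y))) := (Real.sqrt_mul hT0 _).symm
      _ ≤ Real.sqrt (tStart n * (FluidPDE.Torus.scalarL2Sq (w 0) / 2)) := by
          refine Real.sqrt_le_sqrt ?_
          rw [show T * (2 * (X + Y)) = (2 * T) * (X + Y) by ring, show 2 * T = tStart n by rw [hT]; ring]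
          exact mul_le_mul_of_nonneg_left hD (tStart_nonneg n)
  change ∑ j ∈ Finset.range n, Real.sqrt (tHalf j) * (Real.sqrt (DH j) + Real.sqrt (DV j)) ≤ _
  rw [hsum]
  exact (add_le_add hCSH hCSV).trans hkey

/-! ## §3 The `L²` distance between the viscous solution and the inviscid iterate -/

/-- The inviscid iterates are measure-preserving rearrangements: `∫ aₙ² = ∫ a₀²`. [folklore] -/
theorem integral_sq_iterate_eq (hδ₀ : 0 < P.δ₀) (hd : 0 < P.d) (a b : ℕ → UnitAddTorus (Fin 2) → ℝ)
    (hb : ∀ j, b j = a j ∘ shearMap 0 1 (amp ⟨P.U j, P.U_periodic j, P.contDiff_U (P.δ_pos hδ₀ hd j)⟩ P.γ))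
    (hab : ∀ j, a (j + 1) = b j ∘ shearMap 1 0 (amp ⟨P.U j, P.U_periodic j, P.contDiff_U (P.δ_pos hδ₀ hd j)⟩ P.γ))
    (n : ℕ) : ∫ x, a n x ^ 2 = ∫ x, a 0 x ^ 2 := by
  induction n with
  | zero => rfl
  | succ n ih =>
    rw [← ih, hab n]
    have h1 := integral_comp_shearMap (show (1 : Fin 2) ≠ 0 by decide)
      (amp ⟨P.U n, P.U_periodic n, P.contDiff_U (P.δ_pos hδ₀ hd n)⟩ P.γ) (fun x => b n x ^ 2)
    have h2 := integral_comp_shearMap (show (0 : Fin 2) ≠ 1 by decide)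
      (amp ⟨P.U n, P.U_periodic n, P.contDiff_U (P.δ_pos hδ₀ hd n)⟩ P.γ) (fun x => a n x ^ 2)
    simp only [Function.comp_apply] at h1 h2 ⊢
    rw [h1, hb n]
    simp only [Function.comp_apply]
    rw [h2]

/-- **`L²` distance to the inviscid iterate.**  Under the hypotheses of `integral_mul_ge_chain` with `a 0 = w 0`:
`∫ (w(tStart n) − aₙ)² ≤ A · √(2κ · tStart n · ‖w(0)‖²)`.
[cite: BedrossianCotiZelati2017, §2] [cite: DEIJ2022, (1.2)–(1.3)] -/
theorem integral_sub_sq_le (hγ : 0 ≤ P.γ) (hδ₀ : 0 < P.δ₀) (hd : 0 < P.d) (Q : ℕ → ShearProfile)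
    (hQ : ∀ j y, Q j y = deriv (P.U j) y) {κ A : ℝ} (hκ : 0 ≤ κ) (hA : 0 ≤ A)
    {w : ℝ → UnitAddTorus (Fin 2) → ℝ} (hw : FluidPDE.Torus.IsClassicalScalarTransportOn (Ico 0 1) κ P.field w)
    (a b : ℕ → UnitAddTorus (Fin 2) → ℝ) (has : ∀ j, IsSmooth (a j)) (h0 : a 0 = w 0)
    (hb : ∀ j, b j = a j ∘ shearMap 0 1 (amp ⟨P.U j, P.U_periodic j, P.contDiff_U (P.δ_pos hδ₀ hd j)⟩ P.γ))
    (hab : ∀ j, a (j + 1) = b j ∘ shearMap 1 0 (amp ⟨P.U j, P.U_periodic j, P.contDiff_U (P.δ_pos hδ₀ hd j)⟩ P.γ))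
    (n : ℕ)
    (hAH : ∀ j < n, ∀ c ∈ Icc 0 P.γ, (∫ x, partialDeriv (0 : Fin 2) (a j) x ^ 2) +
        ∫ x, (partialDeriv (1 : Fin 2) (a j) x - c * (Q j).onCircle (x 1) * partialDeriv (0 : Fin 2) (a j) x) ^ 2 ≤
          A ^ 2)
    (hAV : ∀ j < n, ∀ c ∈ Icc 0 P.γ, (∫ x, partialDeriv (1 : Fin 2) (b j) x ^ 2) +
        ∫ x, (partialDeriv (0 : Fin 2) (b j) x - c * (Q j).onCircle (x 0) * partialDeriv (1 : Fin 2) (b j) x) ^ 2 ≤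
          A ^ 2) :
    ∫ x, (w (tStart n) x - a n x) ^ 2 ≤
      A * Real.sqrt (2 * κ * tStart n * FluidPDE.Torus.scalarL2Sq (w 0)) := by
  have hchain := integral_mul_ge_chain P hγ hδ₀ hd Q hQ hκ hA hw a b has hb hab n hAH hAV
  have hCS := sum_sqrt_dissipation_le P hκ hw n
  have hT : tStart n ∈ Icc 0 (tStart n) := ⟨tStart_nonneg n, le_rfl⟩
  have hIcc : Icc 0 (tStart n) ⊆ Ico (0 : ℝ) 1 := fun t ht => ⟨ht.1, ht.2.trans_lt (tStart_lt_one n)⟩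
  have hwT : IsSmooth (w (tStart n)) := hw.smooth_scalar.isSmooth_slice (hIcc hT)
  have hw0 : IsSmooth (w 0) := hw.smooth_scalar.isSmooth_slice (hIcc ⟨le_rfl, tStart_nonneg n⟩)
  -- the three pieces of `∫ (w - a)²`
  have hL : FluidPDE.Torus.scalarL2Sq (w (tStart n)) ≤ FluidPDE.Torus.scalarL2Sq (w 0) :=
    hw.antitoneOn_scalarL2Sq hκ hIcc ⟨le_rfl, tStart_nonneg n⟩ hT (tStart_nonneg n)
  have ha2 : ∫ x, a n x ^ 2 = FluidPDE.Torus.scalarL2Sq (w 0) := by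
    rw [integral_sq_iterate_eq P hδ₀ hd a b hb hab n, h0]; rfl
  have haw0 : ∫ x, a 0 x * w 0 x = FluidPDE.Torus.scalarL2Sq (w 0) := by
    rw [h0, FluidPDE.Torus.scalarL2Sq]; exact integral_congr_ae (Eventually.of_forall fun x => by simp [sq])
  have hexp : ∫ x, (w (tStart n) x - a n x) ^ 2 =
      FluidPDE.Torus.scalarL2Sq (w (tStart n)) + (∫ x, a n x ^ 2) - 2 * ∫ x, a n x * w (tStart n) x := by
    have e : (fun x => (w (tStart n) x - a n x) ^ 2) =
        fun x => (w (tStart n) x ^ 2 + a n x ^ 2) - 2 * (a n x * w (tStart n) x) := by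
      funext x; ring
    have i1 : IsSmooth (fun x => w (tStart n) x ^ 2) := hwT.pow 2
    have i2 : IsSmooth (fun x => a n x ^ 2) := (has n).pow 2
    have i12 : IsSmooth (fun x => w (tStart n) x ^ 2 + a n x ^ 2) := i1.add i2
    have i3 : IsSmooth (fun x => a n x * w (tStart n) x) := (has n).mul hwT
    rw [e, integral_sub i12.integrable (i3.integrable.const_mul 2),
      integral_add i1.integrable i2.integrable, integral_const_mul, FluidPDE.Torus.scalarL2Sq]
  -- the deficit
  have hded : A * Real.sqrt κ * ∑ j ∈ Finset.range n, Real.sqrt (tHalf j) *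
        (Real.sqrt (FluidPDE.Torus.scalarDissipation κ w (tStart j) (tStart j + tHalf j)) +
          Real.sqrt (FluidPDE.Torus.scalarDissipation κ w (tStart j + tHalf j) (tStart (j + 1)))) ≤
      A * Real.sqrt κ * Real.sqrt (tStart n * (FluidPDE.Torus.scalarL2Sq (w 0) / 2)) :=
    mul_le_mul_of_nonneg_left hCS (mul_nonneg hA (Real.sqrt_nonneg κ))
  have hid : A * Real.sqrt κ * Real.sqrt (tStart n * (FluidPDE.Torus.scalarL2Sq (w 0) / 2)) =
      A * Real.sqrt (2 * κ * tStart n * FluidPDE.Torus.scalarL2Sq (w 0)) / 2 := by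
    rw [mul_assoc, ← Real.sqrt_mul hκ, show 2 * κ * tStart n * FluidPDE.Torus.scalarL2Sq (w 0) =
      2 ^ 2 * (κ * (tStart n * (FluidPDE.Torus.scalarL2Sq (w 0) / 2))) by ring, Real.sqrt_mul (sq_nonneg 2),
      Real.sqrt_sq (by norm_num : (0 : ℝ) ≤ 2)]
    ring
  rw [hexp, ha2]
  linarith [hchain, hded, hid, haw0, hL]

/-! ## §4 The start socket transferred to the inviscid iterate -/

/-- **The tracked energy of the viscous solution versus that of the inviscid iterate.**  Under the hypotheses of
`integral_sub_sq_le`, for every real symbol `|μ| ≤ 1`: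
`√(Σ' μ(k)² |𝓕(w(tStart n))(k)|²) ≤ √(Σ' μ(k)² |𝓕aₙ(k)|²) + (A √(2κ · tStart n · ‖w(0)‖²))^{1/2}`
(Minkowski in weighted `ℓ²` and Parseval, `…K1Slot.sqrt_tsum_symbol_sq_add_le`).
[cite: Grafakos2014, Prop. 3.2.7 (3)] [cite: DEIJ2022, (1.2)–(1.3)] -/
theorem sqrt_tsum_symbol_sq_le_inviscid_add (hγ : 0 ≤ P.γ) (hδ₀ : 0 < P.δ₀) (hd : 0 < P.d) (Q : ℕ → ShearProfile)
    (hQ : ∀ j y, Q j y = deriv (P.U j) y) {κ A : ℝ} (hκ : 0 ≤ κ) (hA : 0 ≤ A)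
    {w : ℝ → UnitAddTorus (Fin 2) → ℝ} (hw : FluidPDE.Torus.IsClassicalScalarTransportOn (Ico 0 1) κ P.field w)
    (a b : ℕ → UnitAddTorus (Fin 2) → ℝ) (has : ∀ j, IsSmooth (a j)) (h0 : a 0 = w 0)
    (hb : ∀ j, b j = a j ∘ shearMap 0 1 (amp ⟨P.U j, P.U_periodic j, P.contDiff_U (P.δ_pos hδ₀ hd j)⟩ P.γ))
    (hab : ∀ j, a (j + 1) = b j ∘ shearMap 1 0 (amp ⟨P.U j, P.U_periodic j, P.contDiff_U (P.δ_pos hδ₀ hd j)⟩ P.γ))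
    (n : ℕ)
    (hAH : ∀ j < n, ∀ c ∈ Icc 0 P.γ, (∫ x, partialDeriv (0 : Fin 2) (a j) x ^ 2) +
        ∫ x, (partialDeriv (1 : Fin 2) (a j) x - c * (Q j).onCircle (x 1) * partialDeriv (0 : Fin 2) (a j) x) ^ 2 ≤
          A ^ 2)
    (hAV : ∀ j < n, ∀ c ∈ Icc 0 P.γ, (∫ x, partialDeriv (1 : Fin 2) (b j) x ^ 2) +
        ∫ x, (partialDeriv (0 : Fin 2) (b j) x - c * (Q j).onCircle (x 0) * partialDeriv (1 : Fin 2) (b j) x) ^ 2 ≤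
          A ^ 2)
    (μ : (Fin 2 → ℤ) → ℝ) (hμ : ∀ k, |μ k| ≤ 1) :
    Real.sqrt (∑' k, μ k ^ 2 * ‖mFourierCoeff (fun x => (w (tStart n) x : ℂ)) k‖ ^ 2) ≤
      Real.sqrt (∑' k, μ k ^ 2 * ‖mFourierCoeff (fun x => (a n x : ℂ)) k‖ ^ 2) +
        Real.sqrt (A * Real.sqrt (2 * κ * tStart n * FluidPDE.Torus.scalarL2Sq (w 0))) := by
  have hdist := integral_sub_sq_le P hγ hδ₀ hd Q hQ hκ hA hw a b has h0 hb hab n hAH hAV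
  have hT : tStart n ∈ Ico (0 : ℝ) 1 := ⟨tStart_nonneg n, tStart_lt_one n⟩
  have hwT : IsSmooth (w (tStart n)) := hw.smooth_scalar.isSmooth_slice hT
  have hF : Continuous fun x => (a n x : ℂ) := Complex.continuous_ofReal.comp (has n).continuous
  have hG : Continuous fun x => ((w (tStart n) x - a n x : ℝ) : ℂ) :=
    Complex.continuous_ofReal.comp (hwT.continuous.sub (has n).continuous)
  have hμ0 : ∀ k, 0 ≤ μ k ^ 2 := fun k => sq_nonneg _
  have hμ1 : ∀ k, μ k ^ 2 ≤ 1 := fun k => by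
    have h := hμ k
    rw [← sq_abs]; nlinarith [abs_nonneg (μ k)]
  have hM := sqrt_tsum_symbol_sq_add_le hF hG hμ0 hμ1
  have e : (fun x => ((a n x : ℝ) : ℂ) + ((w (tStart n) x - a n x : ℝ) : ℂ)) = fun x => (w (tStart n) x : ℂ) := by
    funext x; push_cast; ring
  rw [e] at hM
  have hGsq : ∫ x, ‖((w (tStart n) x - a n x : ℝ) : ℂ)‖ ^ 2 = ∫ x, (w (tStart n) x - a n x) ^ 2 :=
    integral_congr_ae (Eventually.of_forall fun x => by simp only [Complex.norm_real, Real.norm_eq_abs, sq_abs])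
  rw [hGsq] at hM
  exact hM.trans (add_le_add le_rfl (Real.sqrt_le_sqrt hdist))

/-- **The start socket from the inviscid iterate (`hstart` shape, uniform in `0 < κ ≤ κ₁`).**  Fix `θ₀`, the inviscid
iterate `(a, b)` of `a 0 = θ₀` with transported enstrophies `≤ A²` on the first `n` phases, a symbol `|μ| ≤ 1`, a bound
`√(Σ' μ²|𝓕aₙ|²) ≤ q` and a threshold `κ₁`.  Then every classical cascade scalar `w` on `[0,1)` with `w 0 = θ₀` and diffusivity
`κ ∈ (0, κ₁]` satisfies `√(Σ' μ(k)² |𝓕(w(tStart n))(k)|²) ≤ q + (A √(2κ₁ · tStart n · ‖θ₀‖²))^{1/2}` — the hypothesis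
`hstart` of `…K1Ledger.highModeConcentration_of_ledger_threshold` with `i₀ = n`, `q₀ = q + (A √(2κ₁ tStart n ‖θ₀‖²))^{1/2}`.
[cite: Grafakos2014, Prop. 3.2.7 (3)] [cite: DEIJ2022, (1.2)–(1.3)] -/
theorem sqrt_tsum_symbol_sq_le_of_inviscid (hγ : 0 ≤ P.γ) (hδ₀ : 0 < P.δ₀) (hd : 0 < P.d) (Q : ℕ → ShearProfile)
    (hQ : ∀ j y, Q j y = deriv (P.U j) y) {A : ℝ} (hA : 0 ≤ A) {θ₀ : UnitAddTorus (Fin 2) → ℝ}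
    (a b : ℕ → UnitAddTorus (Fin 2) → ℝ) (has : ∀ j, IsSmooth (a j)) (h0 : a 0 = θ₀)
    (hb : ∀ j, b j = a j ∘ shearMap 0 1 (amp ⟨P.U j, P.U_periodic j, P.contDiff_U (P.δ_pos hδ₀ hd j)⟩ P.γ))
    (hab : ∀ j, a (j + 1) = b j ∘ shearMap 1 0 (amp ⟨P.U j, P.U_periodic j, P.contDiff_U (P.δ_pos hδ₀ hd j)⟩ P.γ))
    (n : ℕ)
    (hAH : ∀ j < n, ∀ c ∈ Icc 0 P.γ, (∫ x, partialDeriv (0 : Fin 2) (a j) x ^ 2) +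
        ∫ x, (partialDeriv (1 : Fin 2) (a j) x - c * (Q j).onCircle (x 1) * partialDeriv (0 : Fin 2) (a j) x) ^ 2 ≤
          A ^ 2)
    (hAV : ∀ j < n, ∀ c ∈ Icc 0 P.γ, (∫ x, partialDeriv (1 : Fin 2) (b j) x ^ 2) +
        ∫ x, (partialDeriv (0 : Fin 2) (b j) x - c * (Q j).onCircle (x 0) * partialDeriv (1 : Fin 2) (b j) x) ^ 2 ≤
          A ^ 2)
    (μ : (Fin 2 → ℤ) → ℝ) (hμ : ∀ k, |μ k| ≤ 1) {q κ₁ : ℝ}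
    (hq : Real.sqrt (∑' k, μ k ^ 2 * ‖mFourierCoeff (fun x => (a n x : ℂ)) k‖ ^ 2) ≤ q) :
    ∀ κ ∈ Ioc (0 : ℝ) κ₁, ∀ w : ℝ → UnitAddTorus (Fin 2) → ℝ,
      FluidPDE.Torus.IsClassicalScalarTransportOn (Ico 0 1) κ P.field w → w 0 = θ₀ →
        Real.sqrt (∑' k, μ k ^ 2 * ‖mFourierCoeff (fun x => (w (tStart n) x : ℂ)) k‖ ^ 2) ≤
          q + Real.sqrt (A * Real.sqrt (2 * κ₁ * tStart n * FluidPDE.Torus.scalarL2Sq θ₀)) := by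
  intro κ hκ w hw hw0
  have h := sqrt_tsum_symbol_sq_le_inviscid_add P hγ hδ₀ hd Q hQ hκ.1.le hA hw a b has (h0.trans hw0.symm) hb hab n
    hAH hAV μ hμ
  rw [hw0] at h
  refine h.trans (add_le_add hq (Real.sqrt_le_sqrt (mul_le_mul_of_nonneg_left (Real.sqrt_le_sqrt ?_) hA)))
  have : 0 ≤ tStart n * FluidPDE.Torus.scalarL2Sq θ₀ := mul_nonneg (tStart_nonneg n) (FluidPDE.Torus.scalarL2Sq_nonneg _)
  nlinarith [hκ.2]

end Summit.AnomalousDissipation.AnomalousDissipation.Theorems.SawtoothPulseCascade.K1Start
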